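import Summits.HodgeConjecture.CorCM.IrreducibleOddWeightsIsotypicSplitting
import Summits.HodgeConjecture.CorCM.IrreducibleOddWeightsShadowModulesOneSided
import HarnessLib

/-!
# Isotypic cells, V: QUANTISATION IN AN ISOTYPIC CLASS — if every constituent of a class has dimension `d`, every
# RIGHT-stable subspace of its container sum, in particular `S(p₀) ∩ S(p₁)` and `S(p)`, has dimension a MULTIPLE of `d`

COR-CM (cell `pub-hodgecm2`, binder seat `b16` gen 70, count-neutral claim ISOTYPIC SPLITTING OF THE DEFECT, file I5 —
abstract `G`-set level, in the lane's own language; theorems only, no definition, no named fact, no `sorry`).  NEW as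
stated, hence under `Summits/`.  HONEST FRAMING: linear algebra of translates of functions on finite `G`-sets: the
container `𝒞_A = Σ_y Θ_y(A)` of file I3 is also the sum `Σ_i S(a_i)` of the RIGHT cells of a basis `(a_i)` of `A`; for
`A` irreducible these right cells are right-irreducible of dimension `dim A` (gen 69 Q7, Q3), so file I1's DIMENSION
QUANTISATION applies to the right translations.  With file I4 this quantises each class of the isotypic splitting of the
defect `dim Hg(A₀)+dim Hg(A₁)−dim Hg(A₀×A₁)`; `HC_CM` is neither used nor asserted.

* §1 `𝒞_A = Σ_i S(a_i)` for any finite family `(a_i)` in `A` spanning `A` (`iSup_map_funLeft_orbit_eq_iSup_span_shadowCoeff`).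
* §2 **CLASS QUANTISATION** (`dvd_finrank_of_rightStable_le_iSup_container`): a class of stable irreducible constituents
  `A⁰_j ≤ ℚ^{Y₀}`, `A¹_j ≤ ℚ^{Y₁}`, ALL OF DIMENSION `d` ⟹ **`d ∣ dim M` for every right-stable
  `M ≤ Σ_j 𝒞_{A⁰_j} + Σ_j 𝒞_{A¹_j}`**.
* §3 **ONE-SIDED**: **`d ∣ dim(S(p₀) ∩ M)`** for `p₀ ∈ Σ_j A⁰_j` and ANY right-stable `M` — in particular for
  `M = S(w₁)`, `w₁` an ARBITRARY partner shadow — and `d ∣ dim S(p₀)`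
  (`dvd_finrank_span_shadowCoeff_inf_of_class`, `…_inf_span_shadowCoeff_of_class`, `dvd_finrank_span_shadowCoeff_of_class`):
  the class defect is `m·d` with `0 ≤ m·d ≤ dim S(p₀)`; one constituent is gen 69 Q7/Q3 (`m ∈ {0,1}`).

## References

* [Serre1977] J.-P. Serre, *Linear Representations of Finite Groups*, GTM 42, §2.6 (canonical decomposition; the
  isotypic component of type `W` has dimension a multiple of `dim W`), §2.2.
* [Lang2002] S. Lang, *Algebra*, 3rd ed., XVII §2.
* [Gordon1999HodgeAVSurvey] B. B. Gordon, *A survey of the Hodge conjecture for abelian varieties*, §3 Theorem (proof),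
  7.5–7.7.
-/

set_option autoImplicit false

noncomputable section

open scoped BigOperators Classical

universe u u' u'' v' v'' w

namespace Summit.HodgeConjecture.CorCM.IrrOdd

variable {G : Type w} [Group G] {Y₀ : Type v'} [MulAction G Y₀] [Fintype Y₀]
  {Y₁ : Type v''} [MulAction G Y₁] [Fintype Y₁]

/-! ### §1 The container as a sum of right cells -/

omit [Fintype Y₀] in
/-- **`𝒞_A = Σ_i S(a_i)`**: for a finite family `(a_i)` in `A` whose span contains `A`, the container `Σ_y Θ_y(A)` is the
sum of the shadow-coefficient spaces `S(a_i)` (the same matrix read by rows and by columns). [cite: Serre1977, §2.6] -/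
theorem iSup_map_funLeft_orbit_eq_iSup_span_shadowCoeff {A : Submodule ℚ (Y₀ → ℚ)} {ι' : Type u} {a : ι' → Y₀ → ℚ}
    (ha : ∀ i, a i ∈ A) (hspan : ∀ x ∈ A, x ∈ Submodule.span ℚ (Set.range a)) :
    (⨆ y : Y₀, A.map (LinearMap.funLeft ℚ ℚ (fun g : G => g • y))) =
      ⨆ i, Submodule.span ℚ (Set.range fun y : Y₀ => fun g : G => a i (g • y)) := by
  refine le_antisymm (iSup_le fun y => ?_) (iSup_le fun i => span_shadowCoeff_le_iSup_map_funLeft_orbit (ha i))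
  have key : ∀ f : Y₀ → ℚ, f ∈ Submodule.span ℚ (Set.range a) →
      LinearMap.funLeft ℚ ℚ (fun g : G => g • y) f ∈
        ⨆ i, Submodule.span ℚ (Set.range fun y : Y₀ => fun g : G => a i (g • y)) := by
    intro f hf
    induction hf using Submodule.span_induction with
    | mem f hf =>
      obtain ⟨i, rfl⟩ := hf
      exact Submodule.mem_iSup_of_mem i (Submodule.subset_span ⟨y, rfl⟩)
    | zero =>
      rw [map_zero]
      exact Submodule.zero_mem _
    | add f f' _ _ hf hf' =>
      rw [map_add]
      exact Submodule.add_mem _ hf hf'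
    | smul t f _ hf =>
      rw [map_smul]
      exact Submodule.smul_mem _ t hf
  rintro _ ⟨x, hx, rfl⟩
  exact key x (hspan x hx)

omit [MulAction G Y₀] [Fintype Y₀] in
/-- Every element of `A` lies in the span of (the coercions of) the vectors of `Module.finBasis ℚ A`. [folklore] -/
theorem mem_span_range_finBasis (A : Submodule ℚ (Y₀ → ℚ)) [FiniteDimensional ℚ A] {x : Y₀ → ℚ} (hx : x ∈ A) :
    x ∈ Submodule.span ℚ (Set.range fun i => ((Module.finBasis ℚ A) i : Y₀ → ℚ)) := by
  have h := (Module.finBasis ℚ A).sum_repr ⟨x, hx⟩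
  have h' : x = ∑ i, (Module.finBasis ℚ A).repr ⟨x, hx⟩ i • ((Module.finBasis ℚ A) i : Y₀ → ℚ) := by
    have h2 := congrArg Subtype.val h
    simp only [Submodule.coe_sum, Submodule.coe_smul] at h2
    exact h2.symm
  rw [h']
  exact Submodule.sum_mem _ fun i _ => Submodule.smul_mem _ _ (Submodule.subset_span ⟨i, rfl⟩)

/-! ### §2 Class quantisation -/

/-- **CLASS QUANTISATION.**  A class of stable irreducible constituents `A⁰_j ≤ ℚ^{Y₀}` (`j ∈ J₀`), `A¹_j ≤ ℚ^{Y₁}`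
(`j ∈ J₁`), all of dimension `d`.  Then `d ∣ dim M` for every RIGHT-stable subspace `M` of the container sum
`Σ_j 𝒞_{A⁰_j} + Σ_j 𝒞_{A¹_j}` — the sum of the right cells `S(a)` of basis vectors of the constituents, each
right-irreducible of dimension `d`. [cite: Serre1977, §2.6] [cite: Lang2002, XVII §2] -/
theorem dvd_finrank_of_rightStable_le_iSup_container {J₀ : Type u} {J₁ : Type u'} [Fintype J₀] [Fintype J₁]
    {A₀ : J₀ → Submodule ℚ (Y₀ → ℚ)} {A₁ : J₁ → Submodule ℚ (Y₁ → ℚ)}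
    (hA₀st : ∀ (j : J₀) (k : G) (a : Y₀ → ℚ), a ∈ A₀ j → (fun y => a (k • y)) ∈ A₀ j)
    (hA₀irr : ∀ (j : J₀) (W : Submodule ℚ (Y₀ → ℚ)), W ≤ A₀ j → W ≠ ⊥ →
      (∀ (k : G) (f : Y₀ → ℚ), f ∈ W → (fun y => f (k • y)) ∈ W) → W = A₀ j)
    (hA₁st : ∀ (j : J₁) (k : G) (a : Y₁ → ℚ), a ∈ A₁ j → (fun y => a (k • y)) ∈ A₁ j)
    (hA₁irr : ∀ (j : J₁) (W : Submodule ℚ (Y₁ → ℚ)), W ≤ A₁ j → W ≠ ⊥ →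
      (∀ (k : G) (f : Y₁ → ℚ), f ∈ W → (fun y => f (k • y)) ∈ W) → W = A₁ j)
    {d : ℕ} (hd₀ : ∀ j, Module.finrank ℚ (A₀ j) = d) (hd₁ : ∀ j, Module.finrank ℚ (A₁ j) = d)
    {M : Submodule ℚ (G → ℚ)} [FiniteDimensional ℚ M]
    (hMst : ∀ (k : G) (c : G → ℚ), c ∈ M → (fun g => c (g * k)) ∈ M)
    (hM : M ≤ (⨆ j, ⨆ y : Y₀, (A₀ j).map (LinearMap.funLeft ℚ ℚ (fun g : G => g • y))) ⊔
      ⨆ j, ⨆ y : Y₁, (A₁ j).map (LinearMap.funLeft ℚ ℚ (fun g : G => g • y))) :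
    d ∣ Module.finrank ℚ M := by
  haveI : ∀ j, FiniteDimensional ℚ (A₀ j) := fun j => Submodule.finiteDimensional_of_le le_top
  haveI : ∀ j, FiniteDimensional ℚ (A₁ j) := fun j => Submodule.finiteDimensional_of_le le_top
  -- right cells of the basis vectors of all constituents
  let b₀ := fun j : J₀ => Module.finBasis ℚ ↥(A₀ j)
  let b₁ := fun j : J₁ => Module.finBasis ℚ ↥(A₁ j)
  let N : (Σ j : J₀, Fin (Module.finrank ℚ ↥(A₀ j))) ⊕ (Σ j : J₁, Fin (Module.finrank ℚ ↥(A₁ j))) →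
      Submodule ℚ (G → ℚ) := fun s => match s with
    | Sum.inl p => Submodule.span ℚ (Set.range fun y : Y₀ => fun g : G => (b₀ p.1 p.2 : Y₀ → ℚ) (g • y))
    | Sum.inr p => Submodule.span ℚ (Set.range fun y : Y₁ => fun g : G => (b₁ p.1 p.2 : Y₁ → ℚ) (g • y))
  -- the right translations as a family of operators
  let T : G → (G → ℚ) →ₗ[ℚ] (G → ℚ) := fun k => LinearMap.funLeft ℚ ℚ (fun g : G => g * k)
  haveI : ∀ s, FiniteDimensional ℚ (N s) := fun s => by
    rcases s with ⟨j, i⟩ | ⟨j, i⟩ <;> exact FiniteDimensional.span_of_finite ℚ (Set.finite_range _)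
  have hNst : ∀ s (k : G) (c : G → ℚ), c ∈ N s → T k c ∈ N s := by
    rintro (⟨j, i⟩ | ⟨j, i⟩) k c hc
    · exact translate_shadowCoeff_mem _ k hc
    · exact translate_shadowCoeff_mem _ k hc
  have hNirr : ∀ s (W : Submodule ℚ (G → ℚ)), W ≤ N s → W ≠ ⊥ →
      (∀ (k : G) (c : G → ℚ), c ∈ W → T k c ∈ W) → W = N s := by
    rintro (⟨j, i⟩ | ⟨j, i⟩) W hW hW0 hWst
    · rcases eq_bot_or_eq_of_rightStable (hA₀st j) (hA₀irr j) (b₀ j i).2 hW (fun k c hc => hWst k c hc) with h | h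
      · exact absurd h hW0
      · exact h
    · rcases eq_bot_or_eq_of_rightStable (hA₁st j) (hA₁irr j) (b₁ j i).2 hW (fun k c hc => hWst k c hc) with h | h
      · exact absurd h hW0
      · exact h
  have hd : ∀ s, N s = ⊥ ∨ Module.finrank ℚ (N s) = d := by
    rintro (⟨j, i⟩ | ⟨j, i⟩)
    · right
      have hne : ((b₀ j i : ↥(A₀ j)) : Y₀ → ℚ) ≠ 0 := fun h =>
        (b₀ j).ne_zero i (Subtype.ext h)
      show Module.finrank ℚ ↥(Submodule.span ℚ (Set.range fun y : Y₀ => fun g : G =>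
        (b₀ j i : Y₀ → ℚ) (g • y))) = d
      rw [finrank_span_shadowCoeff_eq_of_irreducible (hA₀st j) (hA₀irr j) (b₀ j i).2 hne, hd₀ j]
    · right
      have hne : ((b₁ j i : ↥(A₁ j)) : Y₁ → ℚ) ≠ 0 := fun h =>
        (b₁ j).ne_zero i (Subtype.ext h)
      show Module.finrank ℚ ↥(Submodule.span ℚ (Set.range fun y : Y₁ => fun g : G =>
        (b₁ j i : Y₁ → ℚ) (g • y))) = d
      rw [finrank_span_shadowCoeff_eq_of_irreducible (hA₁st j) (hA₁irr j) (b₁ j i).2 hne, hd₁ j]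
  -- the cells sum to the container sum
  have hsum : (⨆ s, N s) = (⨆ j, ⨆ y : Y₀, (A₀ j).map (LinearMap.funLeft ℚ ℚ (fun g : G => g • y))) ⊔
      ⨆ j, ⨆ y : Y₁, (A₁ j).map (LinearMap.funLeft ℚ ℚ (fun g : G => g • y)) := by
    rw [iSup_sum, iSup_sigma, iSup_sigma]
    congr 1
    · refine iSup_congr fun j => ?_
      rw [iSup_map_funLeft_orbit_eq_iSup_span_shadowCoeff (fun i => (b₀ j i).2)
        (fun x hx => mem_span_range_finBasis (A₀ j) hx)]
    · refine iSup_congr fun j => ?_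
      rw [iSup_map_funLeft_orbit_eq_iSup_span_shadowCoeff (fun i => (b₁ j i).2)
        (fun x hx => mem_span_range_finBasis (A₁ j) hx)]
  rw [← hsum] at hM
  exact dvd_finrank_of_stable_le_iSup T hNst hNirr hd (fun k c hc => hMst k c hc) hM

/-! ### §3 The class defect is a multiple of the constituent dimension -/

/-- **ONE-SIDED CLASS QUANTISATION: `d ∣ dim(S(p₀) ∩ M)`** for a shadow `p₀ ∈ Σ_j A⁰_j` in a class of stable
irreducible constituents all of dimension `d` and ANY right-stable `M ≤ ℚ^G` (e.g. `M = S(w₁)` for an arbitrary partner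
shadow, or the partner's matrix-coefficient space); gen 69 Q7 is the case of one constituent (`0` or `d`).
[cite: Serre1977, §2.6] [cite: Gordon1999HodgeAVSurvey, §3 Theorem (proof), 7.5–7.7] -/
theorem dvd_finrank_span_shadowCoeff_inf_of_class {J₀ : Type u} [Fintype J₀] {A₀ : J₀ → Submodule ℚ (Y₀ → ℚ)}
    (hA₀st : ∀ (j : J₀) (k : G) (a : Y₀ → ℚ), a ∈ A₀ j → (fun y => a (k • y)) ∈ A₀ j)
    (hA₀irr : ∀ (j : J₀) (W : Submodule ℚ (Y₀ → ℚ)), W ≤ A₀ j → W ≠ ⊥ →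
      (∀ (k : G) (f : Y₀ → ℚ), f ∈ W → (fun y => f (k • y)) ∈ W) → W = A₀ j)
    {d : ℕ} (hd₀ : ∀ j, Module.finrank ℚ (A₀ j) = d) {p₀ : Y₀ → ℚ} (hp₀ : p₀ ∈ ⨆ j, A₀ j)
    {M : Submodule ℚ (G → ℚ)} (hMst : ∀ (k : G) (c : G → ℚ), c ∈ M → (fun g => c (g * k)) ∈ M) :
    d ∣ Module.finrank ℚ ↥(Submodule.span ℚ (Set.range fun y : Y₀ => fun g : G => p₀ (g • y)) ⊓ M) := by
  haveI : FiniteDimensional ℚ ↥(Submodule.span ℚ (Set.range fun y : Y₀ => fun g : G => p₀ (g • y))) :=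
    FiniteDimensional.span_of_finite ℚ (Set.finite_range _)
  haveI : FiniteDimensional ℚ ↥(Submodule.span ℚ (Set.range fun y : Y₀ => fun g : G => p₀ (g • y)) ⊓ M) :=
    Submodule.finiteDimensional_of_le inf_le_left
  refine dvd_finrank_of_rightStable_le_iSup_container (Y₁ := Y₀) (A₁ := A₀) hA₀st hA₀irr hA₀st hA₀irr hd₀ hd₀
    (fun k c hc => ⟨translate_shadowCoeff_mem _ k hc.1, hMst k c hc.2⟩) ?_
  exact inf_le_left.trans ((span_shadowCoeff_le_iSup_container_of_mem_iSup hp₀).trans le_sup_left)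

/-- `d ∣ dim S(p₀)` for a shadow `p₀ ∈ Σ_j A⁰_j` in a class of stable irreducible constituents all of dimension `d`.
[cite: Serre1977, §2.6] -/
theorem dvd_finrank_span_shadowCoeff_of_class {J₀ : Type u} [Fintype J₀] {A₀ : J₀ → Submodule ℚ (Y₀ → ℚ)}
    (hA₀st : ∀ (j : J₀) (k : G) (a : Y₀ → ℚ), a ∈ A₀ j → (fun y => a (k • y)) ∈ A₀ j)
    (hA₀irr : ∀ (j : J₀) (W : Submodule ℚ (Y₀ → ℚ)), W ≤ A₀ j → W ≠ ⊥ →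
      (∀ (k : G) (f : Y₀ → ℚ), f ∈ W → (fun y => f (k • y)) ∈ W) → W = A₀ j)
    {d : ℕ} (hd₀ : ∀ j, Module.finrank ℚ (A₀ j) = d) {p₀ : Y₀ → ℚ} (hp₀ : p₀ ∈ ⨆ j, A₀ j) :
    d ∣ Module.finrank ℚ ↥(Submodule.span ℚ (Set.range fun y : Y₀ => fun g : G => p₀ (g • y))) := by
  haveI : FiniteDimensional ℚ ↥(Submodule.span ℚ (Set.range fun y : Y₀ => fun g : G => p₀ (g • y))) :=
    FiniteDimensional.span_of_finite ℚ (Set.finite_range _)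
  refine dvd_finrank_of_rightStable_le_iSup_container (Y₁ := Y₀) (A₁ := A₀) hA₀st hA₀irr hA₀st hA₀irr hd₀ hd₀
    (fun k c hc => translate_shadowCoeff_mem _ k hc) ?_
  exact (span_shadowCoeff_le_iSup_container_of_mem_iSup hp₀).trans le_sup_left

omit [Fintype Y₁] in
/-- **THE TWO-PIVOT FORM: `d ∣ dim(S(p₀) ∩ S(w₁))`** for `p₀` in a class of dimension-`d` constituents on `Y₀` and an
ARBITRARY partner shadow `w₁` on `Y₁`. [cite: Serre1977, §2.6] [cite: Gordon1999HodgeAVSurvey, §3 Theorem (proof)] -/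
theorem dvd_finrank_span_shadowCoeff_inf_span_shadowCoeff_of_class {J₀ : Type u} [Fintype J₀]
    {A₀ : J₀ → Submodule ℚ (Y₀ → ℚ)}
    (hA₀st : ∀ (j : J₀) (k : G) (a : Y₀ → ℚ), a ∈ A₀ j → (fun y => a (k • y)) ∈ A₀ j)
    (hA₀irr : ∀ (j : J₀) (W : Submodule ℚ (Y₀ → ℚ)), W ≤ A₀ j → W ≠ ⊥ →
      (∀ (k : G) (f : Y₀ → ℚ), f ∈ W → (fun y => f (k • y)) ∈ W) → W = A₀ j)
    {d : ℕ} (hd₀ : ∀ j, Module.finrank ℚ (A₀ j) = d) {p₀ : Y₀ → ℚ} (hp₀ : p₀ ∈ ⨆ j, A₀ j) (w₁ : Y₁ → ℚ) :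
    d ∣ Module.finrank ℚ ↥(Submodule.span ℚ (Set.range fun y : Y₀ => fun g : G => p₀ (g • y)) ⊓
        Submodule.span ℚ (Set.range fun y : Y₁ => fun g : G => w₁ (g • y))) :=
  dvd_finrank_span_shadowCoeff_inf_of_class hA₀st hA₀irr hd₀ hp₀ fun k _ hc => translate_shadowCoeff_mem _ k hc

/-- **THE CLASS DEFECT IS `m·d` WITH `m·d ≤ dim S(p₀) = m₀·d`.** [cite: Serre1977, §2.6]
[cite: Gordon1999HodgeAVSurvey, §3 Theorem (proof), 7.5–7.7] -/
theorem exists_finrank_span_shadowCoeff_inf_eq_mul_of_class {J₀ : Type u} [Fintype J₀]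
    {A₀ : J₀ → Submodule ℚ (Y₀ → ℚ)}
    (hA₀st : ∀ (j : J₀) (k : G) (a : Y₀ → ℚ), a ∈ A₀ j → (fun y => a (k • y)) ∈ A₀ j)
    (hA₀irr : ∀ (j : J₀) (W : Submodule ℚ (Y₀ → ℚ)), W ≤ A₀ j → W ≠ ⊥ →
      (∀ (k : G) (f : Y₀ → ℚ), f ∈ W → (fun y => f (k • y)) ∈ W) → W = A₀ j)
    {d : ℕ} (hd₀ : ∀ j, Module.finrank ℚ (A₀ j) = d) {p₀ : Y₀ → ℚ} (hp₀ : p₀ ∈ ⨆ j, A₀ j)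
    {M : Submodule ℚ (G → ℚ)} (hMst : ∀ (k : G) (c : G → ℚ), c ∈ M → (fun g => c (g * k)) ∈ M) :
    ∃ m m₀ : ℕ, Module.finrank ℚ ↥(Submodule.span ℚ (Set.range fun y : Y₀ => fun g : G => p₀ (g • y)) ⊓ M) =
        m * d ∧
      Module.finrank ℚ ↥(Submodule.span ℚ (Set.range fun y : Y₀ => fun g : G => p₀ (g • y))) = m₀ * d ∧
      m * d ≤ m₀ * d := by
  obtain ⟨m, hm⟩ := dvd_finrank_span_shadowCoeff_inf_of_class hA₀st hA₀irr hd₀ hp₀ hMst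
  obtain ⟨m₀, hm₀⟩ := dvd_finrank_span_shadowCoeff_of_class hA₀st hA₀irr hd₀ hp₀
  haveI : FiniteDimensional ℚ ↥(Submodule.span ℚ (Set.range fun y : Y₀ => fun g : G => p₀ (g • y))) :=
    FiniteDimensional.span_of_finite ℚ (Set.finite_range _)
  refine ⟨m, m₀, by rw [hm, mul_comm], by rw [hm₀, mul_comm], ?_⟩
  rw [mul_comm m, mul_comm m₀, ← hm, ← hm₀]
  exact Submodule.finrank_mono inf_le_left

end Summit.HodgeConjecture.CorCM.IrrOdd

end
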